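import Mathlib
import HarnessLib
import Summits.NavierStokesRegularity.NavierStokesRegularity.Theorems.PoloidalWindowDoorLrcModEntireTHCertGauge
import Summits.NavierStokesRegularity.NavierStokesRegularity.Theorems.PoloidalWindowDoorLrcModEntireTHCertSliceUD8

/-!
# Route `PoloidalWindowDoor`, item `LrcModEntire` (stmt-NavierStokesRegularity-20428) — the GAUGED (TH) datum in unsteady slice letters
# (`…THCertSliceUD8` + `…THCertGauge`): the currency in which the engines' certificates are written, by name

Cell ns-regularity-ideate, seat ns-poloidal-K2-p3 gen 8 (LEAD of item 20428; `--supports stmt-NavierStokesRegularity-20428`).  The exact-elimination engines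
(cert-1 s3 CERT-MEMO-5 `unsteady_static_RAW_T*.json`, the Gröbner lane) work in complex slice letters AND in the Galilean gauge `w₀₀ = f₁₀ = f₀₁ = 0`.  This file
puts both together: the unsteady slice datum of `…THCertSliceUD8.sliceRelabel` with the point-zero letters `[Rw_0_0, Rf_1_0, If_1_0]` (new-letter indices
[0, 45, 46]), transferred from the Cartesian gauged datum `…THCertGauge.thLocalDatumZ` by `…JetCertGauge.LocalDatumZ.relabel` (`zerosCheck` by `decide`:
`Rw_0_0 = u₂`, `Rf_1_0 = u₀/2`, `If_1_0 = −u₁/2`).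

* `sliceGaugeZeros = [0, 45, 46]`; `sliceZeros_check`;
* `thSliceLocalDatumZ` — from the hypotheses of `stub_localTHEmptyHypNUG` (all but the sign): `LocalDatumZ` in the 189 unsteady slice letters, law `E'`,
  pins `[twist, μ, μ−1, μ_z, Π_NU]`, zeros `[Rw_0_0, Rf_1_0, If_1_0]`;
* `localTHEmptyHypNUG_of_sliceLeafZ` — **THE REGISTERED v4.2 STATEMENT, VERBATIM, FROM ONE GAUGED SLICE-LETTER LEAF CERTIFICATE** (`leafCheckZ` in the
  slice tables; with chunks: fold `LocalDatumZ.extendS` first, then `LocalDatumZ.false_of_leaf`).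

So an engine certificate «pins^e ∈ ⟨E'-rows⟩ + (gauge letters)» in cert-1's letters closes the (TH) stub by name.  WHAT THIS IS NOT: not a claim about
Navier–Stokes and not a certificate — plumbing. [folklore]
-/

noncomputable section

set_option maxRecDepth 100000

-- the summit and its single sub-problem share the name (CONVENTIONS §1), as in every Theorems file
set_option linter.dupNamespace false

namespace Summit.NavierStokesRegularity.NavierStokesRegularity.Theorems.PoloidalWindowDoorLrcModEntireTHCertSliceGaugeUD8

open _root_.Topology _root_.Filter Set Function
open scoped InnerProductSpace Laplacian
open Literature.Analysis.ValidatedNumerics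
open Summit.NavierStokesRegularity.NavierStokesRegularity.Theorems.PoloidalWindowDoorLrcModEntireJetCertDefs
open Summit.NavierStokesRegularity.NavierStokesRegularity.Theorems.PoloidalWindowDoorLrcModEntireJetCertTree
open Summit.NavierStokesRegularity.NavierStokesRegularity.Theorems.PoloidalWindowDoorLrcModEntireJetCertFast2
open Summit.NavierStokesRegularity.NavierStokesRegularity.Theorems.PoloidalWindowDoorLrcModEntireJetCertRelabel
open Summit.NavierStokesRegularity.NavierStokesRegularity.Theorems.PoloidalWindowDoorLrcModEntireJetCertGauge
open Summit.NavierStokesRegularity.NavierStokesRegularity.Theorems.PoloidalWindowDoorLrcModEntireTHCertLetters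
open Summit.NavierStokesRegularity.NavierStokesRegularity.Theorems.PoloidalWindowDoorLrcModEntireTHCert
open Summit.NavierStokesRegularity.NavierStokesRegularity.Theorems.PoloidalWindowDoorLrcModEntireTHCertSteady
open Summit.NavierStokesRegularity.NavierStokesRegularity.Theorems.PoloidalWindowDoorLrcModEntireTHCertGauge
open Summit.NavierStokesRegularity.NavierStokesRegularity.Theorems.PoloidalWindowDoorLrcModEntireTHCertSliceUD8

/-- The point-zero letters of the Galilean gauge in the unsteady slice letters: indices of `Rw_0_0, Rf_1_0, If_1_0`. [folklore] -/
def sliceGaugeZeros : List ℕ := [0, 45, 46]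

/-- The zero-letter transfer checks: each is a multiple of a Cartesian gauge letter (`u₂, u₀/2, −u₁/2`). [folklore] -/
theorem sliceZeros_check : zerosCheck sliceLetters.length sliceRelabel (gaugeZeros sliceLetters) sliceGaugeZeros = true := by
  decide

/-- **THE GAUGED (TH) DATUM IN UNSTEADY SLICE LETTERS**, from the hypotheses of the registered stub (the sign `μ(p₀) < 0` unused). [folklore] -/
theorem thSliceLocalDatumZ
    {u : ℝ → EuclideanSpace ℝ (Fin 3) → EuclideanSpace ℝ (Fin 3)} {μ A : ℝ → ℝ → ℝ}
    {U : Set (ℝ × EuclideanSpace ℝ (Fin 3))} {p₀ : ℝ × EuclideanSpace ℝ (Fin 3)} (hU : IsOpen U) (hp₀ : p₀ ∈ U)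
    (hu : AnalyticOnNhd ℝ (Function.uncurry u) U)
    (hμ : ∀ p ∈ U, AnalyticAt ℝ (Function.uncurry μ) (p.1, p.2 2)) (hA : ∀ p ∈ U, AnalyticAt ℝ (Function.uncurry A) (p.1, p.2 2))
    (hpol : ∀ p ∈ U, fderiv ℝ (u p.1) p.2 (EuclideanSpace.single 0 1) 1 = fderiv ℝ (u p.1) p.2 (EuclideanSpace.single 1 1) 0)
    (hdiv : ∀ p ∈ U, fderiv ℝ (u p.1) p.2 (EuclideanSpace.single 0 1) 0 + fderiv ℝ (u p.1) p.2 (EuclideanSpace.single 1 1) 1 +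
      fderiv ℝ (u p.1) p.2 (EuclideanSpace.single 2 1) 2 = 0)
    (hsh : ∀ p ∈ U, ∀ b : Fin 3, b ≠ 2 →
      fderiv ℝ (u p.1) p.2 (EuclideanSpace.single 2 1) b = μ p.1 (p.2 2) * fderiv ℝ (u p.1) p.2 (EuclideanSpace.single b 1) 2)
    (hE : ∀ p ∈ U,
      (1 - μ p.1 (p.2 2)) *
          (deriv (fun s => u s p.2 2) p.1 + fderiv ℝ (fun y => u p.1 y 2) p.2 (u p.1 p.2) - Δ (fun y => u p.1 y 2) p.2) =
        A p.1 (p.2 2) + (deriv (fun s => μ s (p.2 2)) p.1 - deriv (deriv (μ p.1)) (p.2 2)) * u p.1 p.2 2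
          + deriv (μ p.1) (p.2 2) / 2 * u p.1 p.2 2 ^ 2 - 2 * deriv (μ p.1) (p.2 2) * fderiv ℝ (u p.1) p.2 (EuclideanSpace.single 2 1) 2)
    (htw : fderiv ℝ (fun y => fderiv ℝ (u p₀.1) y (EuclideanSpace.single 2 1) 2) p₀.2 (EuclideanSpace.single 0 1) *
            fderiv ℝ (u p₀.1) p₀.2 (EuclideanSpace.single 1 1) 2 -
          fderiv ℝ (fun y => fderiv ℝ (u p₀.1) y (EuclideanSpace.single 2 1) 2) p₀.2 (EuclideanSpace.single 1 1) *
            fderiv ℝ (u p₀.1) p₀.2 (EuclideanSpace.single 0 1) 2 ≠ 0)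
    (hm0 : μ p₀.1 (p₀.2 2) ≠ 0) (hm1 : μ p₀.1 (p₀.2 2) ≠ 1) (hmz : deriv (μ p₀.1) (p₀.2 2) ≠ 0)
    (hNU : fderiv ℝ (u p₀.1) p₀.2 (EuclideanSpace.single 0 1) 0 ≠ fderiv ℝ (u p₀.1) p₀.2 (EuclideanSpace.single 1 1) 1 ∨
      fderiv ℝ (u p₀.1) p₀.2 (EuclideanSpace.single 1 1) 0 ≠ 0)
    (hrest : u p₀.1 p₀.2 = 0) :
    LocalDatumZ (E := ℝ × EuclideanSpace ℝ (Fin 3)) sliceRelabel.m sliceRelabel.Sf sliceRelabel.Mf dirVec sliceRelabel.hyps' sliceRelabel.pins'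
      sliceGaugeZeros :=
  LocalDatumZ.relabel sliceRelabel sliceGaugeZeros sliceRelabel_check sliceZeros_check
    (thLocalDatumZ sliceLetters sliceLetters_ok hU hp₀ hu hμ hA hpol hdiv hsh hE htw hm0 hm1 hmz hNU hrest)

/-- **THE REGISTERED STUB `stub_localTHEmptyHypNUG` (twist_split v4.2, VERBATIM) FROM ONE GAUGED SLICE-LETTER LEAF CERTIFICATE**: a derivation `steps` from
the single slice law `E'` (in the unsteady slice tables) whose law `k` equals `twist^e₀·μ^e₁·(μ−1)^e₂·μ_z^e₃·Π_NU^e₄` up to terms containing `Rw_0_0`, `Rf_1_0`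
or `If_1_0`. [folklore] -/
theorem localTHEmptyHypNUG_of_sliceLeafZ (steps : List (List (QMvPoly × ℕ × List ℕ))) (k : ℕ) (e : List ℕ)
    (hcheck : leafCheckZ sliceRelabel.m sliceRelabel.Sf sliceRelabel.Mf sliceRelabel.hyps' sliceRelabel.pins' sliceGaugeZeros steps k e = true) :
    ∀ (u : ℝ → EuclideanSpace ℝ (Fin 3) → EuclideanSpace ℝ (Fin 3)) (μ A : ℝ → ℝ → ℝ)
      (U : Set (ℝ × EuclideanSpace ℝ (Fin 3))) (p₀ : ℝ × EuclideanSpace ℝ (Fin 3)),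
      IsOpen U → p₀ ∈ U →
      AnalyticOnNhd ℝ (Function.uncurry u) U →
      (∀ p ∈ U, AnalyticAt ℝ (Function.uncurry μ) (p.1, p.2 2)) →
      (∀ p ∈ U, AnalyticAt ℝ (Function.uncurry A) (p.1, p.2 2)) →
      (∀ p ∈ U, fderiv ℝ (u p.1) p.2 (EuclideanSpace.single 0 1) 1 = fderiv ℝ (u p.1) p.2 (EuclideanSpace.single 1 1) 0) →
      (∀ p ∈ U, fderiv ℝ (u p.1) p.2 (EuclideanSpace.single 0 1) 0 + fderiv ℝ (u p.1) p.2 (EuclideanSpace.single 1 1) 1 +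
        fderiv ℝ (u p.1) p.2 (EuclideanSpace.single 2 1) 2 = 0) →
      (∀ p ∈ U, ∀ b : Fin 3, b ≠ 2 →
        fderiv ℝ (u p.1) p.2 (EuclideanSpace.single 2 1) b =
          μ p.1 (p.2 2) * fderiv ℝ (u p.1) p.2 (EuclideanSpace.single b 1) 2) →
      (∀ p ∈ U,
        (1 - μ p.1 (p.2 2)) *
            (deriv (fun s => u s p.2 2) p.1 + fderiv ℝ (fun y => u p.1 y 2) p.2 (u p.1 p.2)
              - Δ (fun y => u p.1 y 2) p.2) =
          A p.1 (p.2 2) + (deriv (fun s => μ s (p.2 2)) p.1 - deriv (deriv (μ p.1)) (p.2 2)) * u p.1 p.2 2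
            + deriv (μ p.1) (p.2 2) / 2 * u p.1 p.2 2 ^ 2
            - 2 * deriv (μ p.1) (p.2 2) * fderiv ℝ (u p.1) p.2 (EuclideanSpace.single 2 1) 2) →
      fderiv ℝ (fun y => fderiv ℝ (u p₀.1) y (EuclideanSpace.single 2 1) 2) p₀.2 (EuclideanSpace.single 0 1) *
            fderiv ℝ (u p₀.1) p₀.2 (EuclideanSpace.single 1 1) 2 -
          fderiv ℝ (fun y => fderiv ℝ (u p₀.1) y (EuclideanSpace.single 2 1) 2) p₀.2 (EuclideanSpace.single 1 1) *
            fderiv ℝ (u p₀.1) p₀.2 (EuclideanSpace.single 0 1) 2 ≠ 0 →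
      μ p₀.1 (p₀.2 2) ≠ 0 → μ p₀.1 (p₀.2 2) ≠ 1 → deriv (μ p₀.1) (p₀.2 2) ≠ 0 →
      μ p₀.1 (p₀.2 2) < 0 →
      (fderiv ℝ (u p₀.1) p₀.2 (EuclideanSpace.single 0 1) 0 ≠ fderiv ℝ (u p₀.1) p₀.2 (EuclideanSpace.single 1 1) 1 ∨
        fderiv ℝ (u p₀.1) p₀.2 (EuclideanSpace.single 1 1) 0 ≠ 0) →
      u p₀.1 p₀.2 = 0 → False := by
  intro u μ A U p₀ hU hp₀ hu hμ hA hpol hdiv hsh hE htw hm0 hm1 hmz _hneg hNU hrest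
  exact LocalDatumZ.false_of_leaf (thSliceLocalDatumZ hU hp₀ hu hμ hA hpol hdiv hsh hE htw hm0 hm1 hmz hNU hrest) hcheck

end Summit.NavierStokesRegularity.NavierStokesRegularity.Theorems.PoloidalWindowDoorLrcModEntireTHCertSliceGaugeUD8

end
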